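import Mathlib
import Summits.Ventures.PercRepro2.K2nPointSplitRefutation

/-!
# The point-split form on `K_{2,n}` in closed form, and the boundary `n = 21`
(blind cell PercRepro2, night-3 g27, 2026-08-29; `proofs/NIGHT3-CERT.md` §35.10 / §36.8)

For every `n` and every split `a ≤ n` of the leaves, the point-split form `M(1_{v ∈ C_s}, 1)` of
`CovForm.PointSplit.PointSplitBHKOne` on `K_{2,n}` at uniform weight `1/2`, `X = Y = ∅`, with the
principal functionals of the split, equals the explicit rational `psForm n a`
(`mixedForm_K2n_eq_psForm`).  Evaluating it: the form is NONNEGATIVE for every `n ≤ 20` and every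
split, and NEGATIVE at `n = 21`, split `10 + 11` (`psForm_boundary`) — the boundary of g26's §35.10
in the kernel: the censuses of the cell at `n ≤ 8` could not have seen the failure.
Own work; standard axioms.
-/

namespace Summit.Ventures.PercRepro2

namespace K2n

/-- The leaves `ℓ < a` are `a` in number when `a ≤ n`. -/
lemma card_leftLeaves (n a : ℕ) (h : a ≤ n) : (leftLeaves n a).card = a := by
  have hmap : (leftLeaves n a).map ⟨Fin.val, Fin.val_injective⟩ = Finset.range a := by
    ext x
    simp only [leftLeaves, Finset.mem_map, Finset.mem_filter, Finset.mem_univ, true_and,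
      Function.Embedding.coeFn_mk, Finset.mem_range]
    constructor
    · rintro ⟨ℓ, hℓ, rfl⟩
      exact hℓ
    · intro hx
      exact ⟨⟨x, lt_of_lt_of_le hx h⟩, hx, rfl⟩
  rw [← Finset.card_map, hmap, Finset.card_range]

/-- The complement of the left leaves has `n − a` elements. -/
lemma card_leftLeaves_compl (n a : ℕ) (h : a ≤ n) : (leftLeaves n a)ᶜ.card = n - a := by
  rw [Finset.card_compl, Fintype.card_fin, card_leftLeaves n a h]

/-- The closed form of the point-split form `M(1_{v ∈ C_s}, 1)` on `K_{2,n}` at weight `1/2` with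
the principal functionals of the split `a + (n − a)`. -/
def psForm (n a : ℕ) : ℚ :=
  ((3 / 4 : ℚ) ^ n - (1 / 2 : ℚ) ^ n) * 1 +
    ((3 / 4 : ℚ) ^ n - (1 / 2 : ℚ) ^ n + (1 / 4 : ℚ) ^ n) * (1 - (3 / 4 : ℚ) ^ n) -
    ((3 / 4 : ℚ) ^ a - (1 / 2 : ℚ) ^ a * (3 / 4 : ℚ) ^ (n - a)) *
      ((3 / 4 : ℚ) ^ (n - a) - (1 / 2 : ℚ) ^ (n - a) * (3 / 4 : ℚ) ^ (n - (n - a)) +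
        (1 / 4 : ℚ) ^ (n - a) * (3 / 4 : ℚ) ^ (n - (n - a))) -
    ((3 / 4 : ℚ) ^ a - (1 / 2 : ℚ) ^ a * (3 / 4 : ℚ) ^ (n - a) +
        (1 / 4 : ℚ) ^ a * (3 / 4 : ℚ) ^ (n - a)) *
      ((3 / 4 : ℚ) ^ (n - a) - (1 / 2 : ℚ) ^ (n - a) * (3 / 4 : ℚ) ^ (n - (n - a)))

/-- **The point-split form on `K_{2,n}` in closed form.** -/
theorem mixedForm_K2n_eq_psForm (n a : ℕ) (h : a ≤ n) :
    CovForm.PointSplit.mixedFormW (half n) (ends n) 0 ∅ ∅ (FA (leftLeaves n a))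
        (FA (leftLeaves n a)ᶜ) ((connEvent (ends n) 0 1).indicator 1) (fun _ => 1) = psForm n a := by
  unfold CovForm.PointSplit.mixedFormW
  simp only [Finset.inter_self, Finset.union_self, CovForm.PointSplit.wExpect_empty,
    indicator_conn_apply, FA_mul_FA_compl, mul_one, one_mul, expect_FA_conn, expect_FA,
    expect_conn, expect_const, Finset.card_univ, Fintype.card_fin, card_leftLeaves n a h,
    card_leftLeaves_compl n a h, Nat.sub_self, pow_zero]
  unfold psForm
  ring

/-- **The boundary**: the closed form is nonnegative for every `n ≤ 20` and every split, and
negative at `n = 21`, split `10 + 11`. -/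
theorem psForm_boundary :
    (∀ n, n ≤ 20 → ∀ a, a ≤ n → 0 ≤ psForm n a) ∧ psForm 21 10 < 0 := by
  constructor
  · intro n hn a ha
    interval_cases n <;> interval_cases a <;> norm_num [psForm]
  · norm_num [psForm]

/-- The (PS1) instance of `not_pointSplitBHKOne_K2_21` is nonnegative on every `K_{2,n}` with
`n ≤ 20` (every split): the failure starts exactly at `n = 21`. -/
theorem mixedForm_K2n_nonneg_of_le_twenty (n a : ℕ) (hn : n ≤ 20) (h : a ≤ n) :
    0 ≤ CovForm.PointSplit.mixedFormW (half n) (ends n) 0 ∅ ∅ (FA (leftLeaves n a))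
        (FA (leftLeaves n a)ᶜ) ((connEvent (ends n) 0 1).indicator 1) (fun _ => 1) := by
  rw [mixedForm_K2n_eq_psForm n a h]
  exact psForm_boundary.1 n hn a h

end K2n

end Summit.Ventures.PercRepro2
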